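import Summits.NavierStokesRegularity.FluidComputer.RowModel
import HarnessLib

/-!
# The row model, part 2: generic helpers and the a-priori closure on one block (`closureBlock`)

HONEST FRAMING (cell `pub-fluidc`, blueprint seat bp3, gen 20): low prior, high value-of-information
experiment on Tao's machine paradigm; NOT a claim that NS blows up.

This file is §0 of the text `RowModel` (split only for the 400-line rule of the topic directory; see the
module docstring of `RowModel.lean` for the mathematics and R1-DESIGN §9): the entrywise `|M v| ≤ |M||v|`
bound, the SIGNED phase-rate bound `|Φ/(Φ+v) − 1| ≤ D/(Φlo − D)`, the forcing identity as pure matrix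
algebra, the start-of-row sub/super-solution comparison `start_aux_bound` (why only `u` is carried between
rows), and `closureBlock` — the variant of `ImplicitMajorant.rowClosureAux` with the coefficient bound ALSO
conditional on the tube and the phase exception `Ē_p = 0`.

[cite: Tao2016AveragedNS, §5.5 Thm 5.3 (5.5)]
-/

noncomputable section

namespace Summit.NavierStokesRegularity.FluidComputer

namespace RowModel

open Set Real Filter Topology Matrix
open Literature.Analysis.ODE ImplicitMajorant

/-- Entrywise triangle inequality for `M *ᵥ v` against tables `|M| ≤ Mb`, `|v| ≤ vb`. [folklore] -/
theorem abs_mulVec_le {m n : Type*} [Fintype n] {M : Matrix m n ℝ} {v : n → ℝ}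
    {Mb : m → n → ℝ} {vb : n → ℝ} (hM : ∀ i j, |M i j| ≤ Mb i j) (hv : ∀ j, |v j| ≤ vb j)
    (i : m) : |(M *ᵥ v) i| ≤ ∑ j, Mb i j * vb j := by
  rw [Matrix.mulVec_apply_eq_sum]
  refine (Finset.abs_sum_le_sum_abs _ _).trans (Finset.sum_le_sum fun j _ => ?_)
  rw [abs_mul]
  exact mul_le_mul (hM i j) (hv j) (abs_nonneg _) ((abs_nonneg _).trans (hM i j))

/-- **Phase-rate bound, signed form** (`Reparam.ratio_sub_one_le` for `Φ` of either sign): if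
`Φlo ≤ |Φ|`, `|v| ≤ D` and `D < Φlo` then `Φ + v ≠ 0` and `|Φ/(Φ + v) − 1| ≤ D/(Φlo − D)`. [folklore] -/
theorem ratio_sub_one_le_abs {Φ Φlo v D : ℝ} (hΦ : Φlo ≤ |Φ|) (hv : |v| ≤ D) (hD : D < Φlo) :
    Φ + v ≠ 0 ∧ |Φ / (Φ + v) - 1| ≤ D / (Φlo - D) := by
  have hD0 : 0 ≤ D := (abs_nonneg v).trans hv
  have hv1 := neg_abs_le v
  have hv2 := le_abs_self v
  have hmono : ∀ {x : ℝ}, Φlo ≤ x → D / (x - D) ≤ D / (Φlo - D) := fun hx =>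
    div_le_div_of_nonneg_left hD0 (by linarith) (by linarith)
  rcases le_or_gt 0 Φ with hΦ0 | hΦ0
  · rw [abs_of_nonneg hΦ0] at hΦ
    have hΦpos : 0 < Φ := by linarith
    exact ⟨by linarith, (Reparam.ratio_sub_one_le hΦpos hv (by linarith)).trans (hmono hΦ)⟩
  · rw [abs_of_neg hΦ0] at hΦ
    have hΦpos : 0 < -Φ := by linarith
    have hv' : |(-v)| ≤ D := by rwa [abs_neg]
    refine ⟨by linarith, ?_⟩
    have key := Reparam.ratio_sub_one_le hΦpos hv' (by linarith)
    have heq : Φ / (Φ + v) = -Φ / (-Φ + -v) := by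
      rw [show -Φ + -v = -(Φ + v) by ring, neg_div_neg_eq]
    rw [heq]
    exact key.trans (hmono hΦ)

/-- **The forcing identity** (R1-DESIGN §7.1) as pure matrix algebra: with `z = A e` reconstructed as
`e = G z + R e` and `ė = ṡ P (J e + w)`,
`Ȧ e + A ė − (ȦG + ṡ APJG) z = (ȦR) e + ṡ ((APJR) e + (AP) w)`. [folklore] -/
theorem forcing_identity {m n : Type*} [Fintype m] [Fintype n]
    {Am Am' : Matrix m n ℝ} {G : Matrix n m ℝ} {Rr Pt Jm : Matrix n n ℝ} {e w : n → ℝ}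
    {z : m → ℝ} {sd : ℝ} (hrec : G *ᵥ z + Rr *ᵥ e = e) :
    Am' *ᵥ e + Am *ᵥ (sd • (Pt *ᵥ (Jm *ᵥ e + w))) - (Am' * G + sd • (Am * Pt * Jm * G)) *ᵥ z
      = (Am' * Rr) *ᵥ e + sd • ((Am * Pt * Jm * Rr) *ᵥ e + (Am * Pt) *ᵥ w) := by
  have h1 : Am' *ᵥ e = Am' *ᵥ (G *ᵥ z + Rr *ᵥ e) := by rw [hrec]
  have h2 : Jm *ᵥ e = Jm *ᵥ (G *ᵥ z + Rr *ᵥ e) := by rw [hrec]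
  rw [h1, h2]
  simp only [Matrix.mulVec_add, Matrix.mulVec_smul, Matrix.mulVec_mulVec, Matrix.add_mulVec,
    Matrix.smul_mulVec, smul_add, Matrix.mul_assoc]
  abel

/-- **Start-of-row auxiliary bound** (sub/super-solution comparison; how the kernel may carry only `u`
between rows): if `x ≤ a + Rm x` entrywise with `a, Rm ≥ 0`, `x p = 0`, and `Ē ≥ 0` is a STRICT
super-solution off the phase coordinate (`a_b + Σ Rm b b' Ē b' < Ē b` for `b ≠ p`), then `x ≤ Ē`.
(Proof: the maximal ratio `θ = max_b x_b/Ē_b` cannot exceed `1`.) [folklore] -/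
theorem start_aux_bound {κ : Type*} [Fintype κ] {x a Ebar : κ → ℝ} {Rm : κ → κ → ℝ} (p : κ)
    (hR0 : ∀ b b', 0 ≤ Rm b b') (ha0 : ∀ b, 0 ≤ a b)
    (hx : ∀ b, x b ≤ a b + ∑ b', Rm b b' * x b') (hxp : x p = 0)
    (hE0 : ∀ b, 0 ≤ Ebar b)
    (hE : ∀ b, b ≠ p → a b + ∑ b', Rm b b' * Ebar b' < Ebar b) :
    ∀ b, x b ≤ Ebar b := by
  classical
  have hEpos : ∀ b, b ≠ p → 0 < Ebar b := by
    intro b hb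
    have h1 : 0 ≤ ∑ b', Rm b b' * Ebar b' :=
      Finset.sum_nonneg fun b' _ => mul_nonneg (hR0 b b') (hE0 b')
    linarith [hE b hb, ha0 b]
  by_contra hcon
  simp only [not_forall, not_le] at hcon
  obtain ⟨b₁, hb₁⟩ := hcon
  have hb₁p : b₁ ≠ p := by
    rintro rfl
    linarith [hE0 b₁]
  let U : Finset κ := Finset.univ.filter (fun b => b ≠ p)
  have hU : U.Nonempty := ⟨b₁, by simp [U, hb₁p]⟩
  obtain ⟨b₀, hb₀U, hmax⟩ := Finset.exists_max_image U (fun b => x b / Ebar b) hU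
  have hb₀p : b₀ ≠ p := by simpa [U] using hb₀U
  have hE₀ : 0 < Ebar b₀ := hEpos b₀ hb₀p
  set θ := x b₀ / Ebar b₀ with hθ
  have hθ1 : 1 < θ := by
    have h1 : x b₁ / Ebar b₁ ≤ θ := hmax b₁ (by simp [U, hb₁p])
    have h2 : 1 < x b₁ / Ebar b₁ := by
      rw [lt_div_iff₀ (hEpos b₁ hb₁p)]
      linarith
    linarith
  have hxθ : ∀ b', x b' ≤ θ * Ebar b' := by
    intro b'
    by_cases hb' : b' = p
    · rw [hb', hxp]
      exact mul_nonneg (by linarith) (hE0 p)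
    · have := hmax b' (by simp [U, hb'])
      rwa [div_le_iff₀ (hEpos b' hb')] at this
  have h1 : ∑ b', Rm b₀ b' * x b' ≤ θ * ∑ b', Rm b₀ b' * Ebar b' := by
    rw [Finset.mul_sum]
    refine Finset.sum_le_sum fun b' _ => ?_
    have := mul_le_mul_of_nonneg_left (hxθ b') (hR0 b₀ b')
    linarith
  have h2 : x b₀ = θ * Ebar b₀ := by
    rw [hθ, div_mul_cancel₀ _ hE₀.ne']
  have h3 := hx b₀
  have h4 : θ * a b₀ + θ * ∑ b', Rm b₀ b' * Ebar b' < θ * Ebar b₀ := by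
    have := mul_lt_mul_of_pos_left (hE b₀ hb₀p) (by linarith : (0:ℝ) < θ)
    rwa [mul_add] at this
  have h5 : a b₀ ≤ θ * a b₀ := le_mul_of_one_le_left (ha0 b₀) hθ1.le
  linarith

/-- **A-priori closure with an auxiliary state, conditional coefficient and phase exception** — the
variant of `ImplicitMajorant.rowClosureAux` this file needs: the coefficient bound `hK` is assumed only
while `|e| ≤ Ē` (the kernel hulls `K = ȦT̂ + ṡAP̃JT̂` over `ṡ ∈ [1−ρ, 1+ρ]`, and `ṡ` is controlled only
inside the tube), the forcing bound only while `|z| ≤ W̄` and `|e| ≤ Ē` (both POINTWISE at the current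
time), and the strict closure row `G W̄ + Rm Ē < Ē` is required off the phase coordinate `p` only, where
instead `e_p ≡ 0` and `0 ≤ Ē_p`. Conclusion as in `rowClosureAux`. [folklore] -/
theorem closureBlock {ι : Type*} [Fintype ι] [DecidableEq ι] {κ : Type*} [Fintype κ]
    {z : ℝ → ι → ℝ} {K : ℝ → ι → ι → ℝ} {f : ℝ → ι → ℝ}
    {B E : ι → ι → ℝ} {φ u : ι → ℝ} {T₀ T₁ h c η' : ℝ} (S : ℕ)
    (A : ℕ → ι → ι → ℝ) (b : ℕ → ι → ℝ) (Wbar : ι → ℝ)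
    {e : ℝ → κ → ℝ} (p : κ) (G : κ → ι → ℝ) (Rm : κ → κ → ℝ) (Ebar : κ → ℝ)
    (hh : 0 < h) (hc : 0 ≤ c) (hT₁ : T₀ ≤ T₁) (hT₁' : T₁ ≤ T₀ + 2 ^ S * h)
    (hzc : ∀ i, ContinuousOn (fun s => z s i) (Icc T₀ T₁))
    (hz : ∀ s ∈ Ico T₀ T₁, ∀ i,
      HasDerivWithinAt (fun r => z r i) (∑ j, K s i j * z s j + f s i) (Ici s) s)
    (hK : ∀ s ∈ Ico T₀ T₁, (∀ a, |e s a| ≤ Ebar a) →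
      ∀ i j, |K s i j + (if i = j then c else 0)| ≤ B i j)
    (hec : ∀ a, ContinuousOn (fun s => e s a) (Icc T₀ T₁))
    (herel : ∀ s ∈ Icc T₀ T₁, ∀ a, |e s a| ≤ ∑ i, G a i * |z s i| + ∑ b', Rm a b' * |e s b'|)
    (hG0 : ∀ a i, 0 ≤ G a i) (hR0 : ∀ a b', 0 ≤ Rm a b')
    (hf : ∀ s ∈ Ico T₀ T₁, (∀ i, |z s i| ≤ Wbar i) → (∀ a, |e s a| ≤ Ebar a) →
      ∀ i, |f s i| ≤ φ i)
    (hB0 : ∀ i j, 0 ≤ B i j) (hφ0 : ∀ i, 0 ≤ φ i)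
    (hE0 : ∀ i k, 0 ≤ E i k)
    (hE : ∀ w : ι → ℝ, (∀ k, 0 ≤ w k) →
      ∀ i, w i + h * ∑ j, B i j * (∑ k, E j k * w k) ≤ ∑ k, E i k * w k)
    (hη' : exp (c * h) ≤ η')
    (hA0 : ∀ i k, E i k ≤ A 0 i k)
    (hb0 : ∀ i, ∑ k, E i k * (h * (η' * φ k)) ≤ b 0 i)
    (hAsq : ∀ n < S, ∀ i k, ∑ j, A n i j * A n j k ≤ A (n + 1) i k)
    (hbsq : ∀ n < S, ∀ i, ∑ j, A n i j * b n j + b n i ≤ b (n + 1) i)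
    (hAI : ∀ n ≤ S, ∀ i k, (if i = k then (1:ℝ) else 0) ≤ A n i k)
    (hbn : ∀ n ≤ S, ∀ i, 0 ≤ b n i)
    (hW : ∀ i, ∑ k, A S i k * u k + b S i < Wbar i)
    (hEbar : ∀ a, a ≠ p → ∑ i, G a i * Wbar i + ∑ b', Rm a b' * Ebar b' < Ebar a)
    (hep : ∀ s ∈ Icc T₀ T₁, e s p = 0) (hEp : 0 ≤ Ebar p)
    (hu : ∀ i, |z T₀ i| ≤ u i) (he0 : ∀ a, |e T₀ a| ≤ Ebar a) :
    (∀ s ∈ Icc T₀ T₁, ∀ i, |z s i| ≤ ∑ k, A S i k * u k + b S i) ∧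
      (∀ s ∈ Icc T₀ T₁, ∀ a, |e s a| ≤ Ebar a) := by
  classical
  have hu0 : ∀ k, 0 ≤ u k := fun k => (abs_nonneg _).trans (hu k)
  have hinflS : ∀ i, u i ≤ ∑ k, A S i k * u k + b S i := by
    intro i
    have h1 : ∑ k, (if i = k then (1:ℝ) else 0) * u k ≤ ∑ k, A S i k * u k :=
      Finset.sum_le_sum fun k _ => mul_le_mul_of_nonneg_right (hAI S le_rfl i k) (hu0 k)
    have h2 : ∑ k, (if i = k then (1:ℝ) else 0) * u k = u i := by
      simp [ite_mul, Finset.sum_ite_eq, Finset.mem_univ]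
    linarith [hbn S le_rfl i]
  let P : ℝ → Prop := fun t => (∀ i, |z t i| ≤ Wbar i) ∧ (∀ a, |e t a| ≤ Ebar a)
  have hPa : P T₀ := ⟨fun i => ((hu i).trans (hinflS i)).trans (hW i).le, he0⟩
  have hclosed : ∀ t ∈ Ioc T₀ T₁, (∀ s ∈ Ico T₀ t, P s) → P t := by
    intro t ht hP
    exact ⟨fun i => le_const_of_forall_Ico ((hzc i).abs) ht fun s hs => (hP s hs).1 i,
      fun a => le_const_of_forall_Ico ((hec a).abs) ht fun s hs => (hP s hs).2 a⟩
  set T := maximalTimeP P T₀ T₁ with hT_def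
  have hTmem : T ∈ Icc T₀ T₁ := maximalTimeP_mem hT₁ hPa
  have hPT : ∀ t ∈ Icc T₀ T, P t := fun t ht => maximalTimeP_spec hT₁ hPa hclosed ht
  have hsubc : Icc T₀ T ⊆ Icc T₀ T₁ := Icc_subset_Icc_right hTmem.2
  have hsubo : Ico T₀ T ⊆ Ico T₀ T₁ := Ico_subset_Ico_right hTmem.2
  have hfT : ∀ s ∈ Ico T₀ T, ∀ i, |f s i| ≤ φ i := fun s hs =>
    hf s (hsubo hs) (hPT s ⟨hs.1, hs.2.le⟩).1 (hPT s ⟨hs.1, hs.2.le⟩).2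
  have hKT : ∀ s ∈ Ico T₀ T, ∀ i j, |K s i j + (if i = j then c else 0)| ≤ B i j := fun s hs =>
    hK s (hsubo hs) (hPT s ⟨hs.1, hs.2.le⟩).2
  have hrow := rowInterior S A b hh hc hTmem.1 (hTmem.2.trans hT₁') (fun i => (hzc i).mono hsubc)
    (fun s hs i => hz s (hsubo hs) i) hKT hfT hB0 hφ0 hE0 hE hη'
    hA0 hb0 hAsq hbsq hAI hbn hu
  -- the auxiliary bound is strict at T off the phase coordinate
  have heT : ∀ a, a ≠ p → |e T a| < Ebar a := by
    intro a hap
    have hPTT := hPT T ⟨hTmem.1, le_rfl⟩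
    have h1 := herel T hTmem a
    have h2 : ∑ i, G a i * |z T i| ≤ ∑ i, G a i * Wbar i :=
      Finset.sum_le_sum fun i _ => mul_le_mul_of_nonneg_left (hPTT.1 i) (hG0 a i)
    have h3 : ∑ b', Rm a b' * |e T b'| ≤ ∑ b', Rm a b' * Ebar b' :=
      Finset.sum_le_sum fun b' _ => mul_le_mul_of_nonneg_left (hPTT.2 b') (hR0 a b')
    linarith [hEbar a hap]
  have hT : T = T₁ := by
    rcases maximalTimeP_exit hT₁ hPa with h1 | h1
    · exact h1
    · exfalso
      apply h1
      have hz' : ∀ i, ∀ᶠ t in 𝓝[Icc T₀ T₁] T, |z t i| ≤ Wbar i := by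
        intro i
        have hlt : |z T i| < Wbar i := (hrow T ⟨hTmem.1, le_rfl⟩ i).trans_lt (hW i)
        have hcw : ContinuousWithinAt (fun s => |z s i|) (Icc T₀ T₁) T := ((hzc i).abs) T hTmem
        exact (hcw.eventually_lt_const hlt).mono fun _ h => h.le
      have he' : ∀ a, ∀ᶠ t in 𝓝[Icc T₀ T₁] T, |e t a| ≤ Ebar a := by
        intro a
        by_cases hap : a = p
        · rw [hap]
          exact eventually_nhdsWithin_of_forall fun t ht => by rw [hep t ht, abs_zero]; exact hEp
        · have hcw : ContinuousWithinAt (fun s => |e s a|) (Icc T₀ T₁) T := ((hec a).abs) T hTmem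
          exact (hcw.eventually_lt_const (heT a hap)).mono fun _ h => h.le
      exact (Filter.eventually_all.2 hz').and (Filter.eventually_all.2 he') |>.mono
        fun t ht => ⟨ht.1, ht.2⟩
  refine ⟨fun s hs i => hrow s ⟨hs.1, hT.symm ▸ hs.2⟩ i, fun s hs a => ?_⟩
  exact (hPT s ⟨hs.1, hT.symm ▸ hs.2⟩).2 a

end RowModel

end Summit.NavierStokesRegularity.FluidComputer
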